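import Summits.QuantumFields.YangMills.Theorems.BalabanUVNodesN05AtXPinnedHSViewSepCoPHOfLeaf
import Summits.QuantumFields.YangMills.Theorems.BalabanUVNodesN05SubBHKnitUnivOfThm33

/-!
# BalabanUVNodes ∕ N05 ([B8], `Dag.B8_main`) AT THE K1 ENGINE'S X-PINNED VIEW (v1.7 key `SepCoPH`) — THE J-N06→N05 JUNCTION APPLIED ON THE `Ω₀ = ℤᵈ` ROAD, READ AT
# THE RECORD: N05 in ∃-currency at the S-BOUND FOUR-PIN X-H record `Node00.IsRecordOfRecord₁₃CSepCoPHSX3HV` with the [B8] residual layer's constants PRODUCED, fed by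
# `BalabanUVNodesN05SubBHKnitUnivOfThm33` (N06's Theorem 3.3 BY NAME + dag-n06-b's operator dictionary + [4] Thm 3.1-type letters + N05's printed Props 6 ∕ 7 displayed)
# (+ the same-datum `₁₃CSepCoPH` companion), through the GENERIC leaf-to-record face `BalabanUVNodesN05AtXPinnedHSViewSepCoPHOfLeaf`

Track A of `YM-PLAN.md` (cell `pub-ymgap`, HUMAN RULING D-0062), node **N05** = [Balaban1985RegularSpaces] Lemma 1, Thm 2, Prop 3, Thm 4, Props 5–7, Thm 8; seat
`pub-ymgap-dag-n05-d` (g8), 2026-08-27; strategy s2.  Inputs BY NAME: `BalabanUVNodesN05SubBHKnitUnivOfThm33.exists_b8LeafOfRecordSubBH_cutSubB_zdLan_of_thm33_lettersRDU_univ`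
(this seat g8: the junction applied, layer constants produced), `Node00/Record13CarriersXPinnedHSViewCoPH` (this seat g7, p548139: the S-bound four-pin X-H v1.7 record,
`exists_world_isRecordOfRecord₁₃CSepCoPH`, `companion_of_isRecordOfRecord₁₃CSepCoPHSX3HV`, `socket05S_view₁₃CoPHB10YZW_pinX3H_iff`, `b8_b11_b10_main_iff_of_…`).
The served-knit image `BalabanUVNodesN05AtXPinnedHSViewSepCoPHT8Srv` (p549041) took the layer `lam` and the three b9 sockets as binders; THIS file's ★ theorem takes N06's
Theorem 3.3 by name instead and PRODUCES the layer's constants.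

WHAT IS PROVED (composition BY NAME; no estimate; no new definition):
* ★ **`exists_isRecordOfRecord₁₃CSepCoPHSX3HV_b8_of_thm33_lettersRDU_univ`** — N05 AT THE H-X-PIN FROM N06's THEOREM 3.3 BY NAME: admissible `θ : Stage13HParams F N` with
  v1.7 provisos `h`, ANY consumer layer `lam₀ : ResidB8 θ.toStage3Params` and the inputs of `…KnitUnivOfThm33` AT `θ.toStage3Params` ([4] Thm 3.1-type letters `SLet ∕ SLetUB`
  at the `Ω₀ = ℤᵈ` law members and `SLetL ∕ SLetLU` at the Prop.-5 members `ι`; `h33 : B9.Thm33Printed c35 geo bg Gp GA`; dag-n06-b's member-local dictionary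
  `DictAt ∕ Prop6At ∕ InvAt ∕ CurvAt ∕ LandauAt ∕ AvgAt ∕ HolderAt ∕ GopAddAt ∕ SrcAt ∕ SrcHolderAt` at the law members; N05's printed `p6` at `(B₁⁰, c₁)` and `p7`) ⇒ for
  every `γw ∈ ]0, θ.γ]` THERE EXIST [B9] inputs and constants `inp C₂ B₁′ B₁ B₂ B₀β` (`B₁ ≥ B₁⁰`) and worlds `w w′` — `IsRecordOfRecord₁₃CSepCoPHSX3HV F N (datumOfRecord₁₃SepCoPH θ h) w`,
  EVERY run's `b8` leaf and `Dag.B8_main`, the same-datum `₁₃CSepCoPH` companion `w′` (via `…OfLeaf.exists_isRecordOfRecord₁₃CSepCoPHSX3HV_b8_of_leaf`) — the binding displayed at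
  `(θ.pinX3H ({lam₀ with inp, C₂, B₁′, B₁, B₂, B₀β}.cutSubB J (zdLan θ.L B₁ ∘ ι) c₁) lam12 lam13).view₁₃CoPHB10YZW Mstar ops ζ lamW`.
So at the engine's view the other X-sockets (N09 at `lam12`, N10 at `lam13`) and the Y ∕ Z ∕ W leaves are read at the SAME world as N05, and the b9 half of N05's
in-edge from N06 is consumed BY NAME (`B9.Thm33Printed`), not as [4]-type sockets.
A6 (director-ym №189 (3)): as in `…KnitUnivOfThm33` — the dictionary binders are inhabited at every truncation-0 member by dag-n06-b's p544605 ∕ p547642 (trivial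
massive regime), `m ≥ 1` A6-UNCHECKED; the letters `SLet…` have no in-tree provider ∕ witness; `p7` junk-inhabitable as typed; A2: inhabitation of `(θ, h)` = K0⁷ (open).
HONEST FRAMING: kernel bookkeeping by name; all sockets ∕ dictionary binders are HYPOTHESES; `p6 ∕ p7 ∕ Prop6At` are HYPOTHESES = N05's own printed members NOT
discharged; count-neutral; **N05 NOT discharged**; K1 NOT claimed; Bałaban AS PRINTED with locators; one finite 𝕋⁴ programme at fixed ε; nothing continuum ∕ ℝ⁴ ∕ OS ∕
mass-gap ∕ Clay.  No `sorry`, no new definition.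
[cite: Balaban1985RegularSpaces, Lemma 1 p.79, Thm 2 p.83, Prop. 3 p.87, Thm 4 p.88, Prop. 5 (1.106)–(1.110) p.94, Thm 8 (1.146) p.101 (supplied modulo the displayed hypotheses), Prop. 6 (1.131)–(1.136) p.99, Prop. 7 p.100 (named hypotheses); Balaban1985BackgroundPropagators, Thm 3.3 p.399 (by name), Thm 3.1 p.397, (3.16)–(3.69) pp.393–404 (dictionary hypotheses); Balaban1989LargeFieldII, Thm 1 + (0.1) pp.355–356 (the record, bookkeeping)]
-/

noncomputable section

namespace Summit.QuantumFields.YangMills.BalabanUVNodes.N05AtXPinnedHSViewSepCoPHOfThm33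


open Literature.MathematicalPhysics.QuantumFieldTheory.Balaban1983to89
open Literature.MathematicalPhysics.QuantumFieldTheory.Balaban1983to89.Node00
open Literature.MathematicalPhysics.QuantumFieldTheory.Balaban1983to89.T4Continuum
open Literature.MathematicalPhysics.QuantumFieldTheory.Balaban1983to89.DagBinding
open Literature.MathematicalPhysics.QuantumFieldTheory.Balaban1983to89.B8IdxB8LawsB (towerBonds IdxB8LawsB IdxB8SubB famB8OfRecordSubB)
open Literature.MathematicalPhysics.QuantumFieldTheory.Balaban1983to89.B8LeafModelZd (ZdIdx)
open Literature.MathematicalPhysics.QuantumFieldTheory.Balaban1983to89.B8LeafModelZd3 (SockB9P3)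
open Literature.MathematicalPhysics.QuantumFieldTheory.Balaban1983to89.B8SockLettersRD (SockLettersRD)
open Literature.MathematicalPhysics.QuantumFieldTheory.Balaban1983to89.B8Lemma1NonAbelian (mulCfg blockPairNA)
open Literature.MathematicalPhysics.QuantumFieldTheory.Balaban1983to89.B8Prop5LandauDataZd (ZdLanIdx zdLan)
open Literature.MathematicalPhysics.QuantumFieldTheory.Balaban1983to89.B9SupplySockB9P3ZdLetters (OpsZd)
open Literature.MathematicalPhysics.QuantumFieldTheory.Balaban1983to89.B9SupplySockB9P3ZdAt (DictAt Prop6At InvAt CurvAt LandauAt AvgAt HolderAt GopAddAt SrcAt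
  SrcHolderAt)
open Summit.QuantumFields.YangMills.BalabanUVNodes.N05SubBHKnitUnivOfThm33 (exists_b8LeafOfRecordSubBH_cutSubB_zdLan_of_thm33_lettersRDU_univ)
open Summit.QuantumFields.YangMills.BalabanUVNodes.N05AtXPinnedHSViewSepCoPHOfLeaf (exists_isRecordOfRecord₁₃CSepCoPHSX3HV_b8_of_leaf exists_isRecordOfRecord₁₃CSepCoPHS_b8_of_leaf)
open MatrixLog B7Prop1Explicit B7Prop2Explicit B7Prop1Local B7Eq92Concrete
open B8Ineq130 (tlo thi)
open B8Ineq132 (InAk covDerivFwd)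
open B7Eq78Linearization (zdBlocking QprimeIter)
open B8Eq119TwistedAxial (bgT Restr129 InAx)
open B8Eq140Level (SideTouches)
open B8Eq138LandauZd (covLap QT InR138 IsLandau146W)
open B8Eq1117Concrete (XSpace)
open B8Prop5ContractionKLevel (Bd2)
open B8LambdaSpaceKLevel (wt)
open B8Eq184Proof (gaugeExp cfgExp)
open B8Eq146AExpansion (iEta)
open B7Prop4GeneralLevels (linCovIter)
open B8Eq155JBound (Jcur wsup)
open B8ScaledSupNorm (bondNorm msup Bdd)
open B9Eq340HolderZd (hquot AdmPair)

-- `Site` alone could resolve to the torus sites of `Setup.lean`; re-export the `ℤ^d` sites of `B7Prop1Explicit`.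
export B7Prop1Explicit (Site)

variable {F : T4Family} {N : ℕ} [NeZero N]

/-! ## ★ N05 at the H-X-pin FROM N06's THEOREM 3.3 BY NAME (layer constants produced) -/

section Record

/-- ★ **N05 IN ∃-CURRENCY AT THE STAGE-13 RECORD OF RECORD, FROM N06's THEOREM 3.3 BY NAME** (four-pin S-bound X-H v1.7 record + same-datum `₁₃CSepCoPH` companion).
ADMISSIBLE Stage-13 parameters `θ` WITH v1.7 PROVISOS `h`, ANY consumer layer `lam₀` and the inputs of
`BalabanUVNodesN05SubBHKnitUnivOfThm33.exists_b8LeafOfRecordSubBH_cutSubB_zdLan_of_thm33_lettersRDU_univ` AT `θ.toStage3Params` — [4] Thm 3.1-type letters (`SLet ∕ SLetUB`) at the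
`Ω₀ = ℤᵈ` LAW members and (`SLetL ∕ SLetLU`) at the Prop.-5 members `ι` (with their three member laws); N06's `h33 : B9.Thm33Printed c35 geo bg Gp GA` BY NAME; dag-n06-b's
member-local operator dictionary at the law members (`hdict hP6at hinv hcurv hlan havg hhol hadd hsrc hsrcH`); N05's printed members `p6` (Prop. 6 p. 99 on the record's cube family
at `(B₁⁰, c₁)`) and `p7` (Prop. 7 p. 100 for `lam₀`'s axial map) — give, for every window `γw ∈ ]0, θ.γ]`, [B9] inputs and constants `inp C₂ B₁′ B₁ B₂ B₀β` (`B₁⁰ ≤ B₁`) and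
worlds `w w′`: `IsRecordOfRecord₁₃CSepCoPHSX3HV F N (datumOfRecord₁₃SepCoPH θ h) w` with its binding DISPLAYED at the cut layer
`(θ.pinX3H ({lam₀ with inp, C₂, B₁′, B₁, B₂, B₀β}.cutSubB J (zdLan θ.L B₁ ∘ ι) c₁) lam12 lam13).view₁₃CoPHB10YZW Mstar ops ζ lamW`, EVERY run's `b8` leaf and `Dag.B8_main (leavesP w P)`,
and the same-datum companion `IsRecordOfRecord₁₃CSepCoPH … w′`.  NOT a discharge of N05: the dictionary, the letters, `Prop6At`, `p6`, `p7` are hypotheses.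
[cite: Balaban1985RegularSpaces, Lemma 1 p.79, Thm 2 p.83, Prop. 3 p.87, Thm 4 p.88, Prop. 5 p.94, Thm 8 (1.146) p.101; Prop. 6 p.99, Prop. 7 p.100 (named hypotheses); Balaban1985BackgroundPropagators, Thm 3.3 p.399 (by name), Thm 3.1 p.397 (hypotheses); Balaban1989LargeFieldII, Thm 1 + (0.1) pp.355–356 (the record, bookkeeping)] -/
theorem exists_isRecordOfRecord₁₃CSepCoPHSX3HV_b8_of_thm33_lettersRDU_univ (θ : Stage13HParams F N) (h : θ.Provisos₁₃SepCoPH F N) (hθ : θ.Admissible F N)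
    (lam12 : ResidB12 F N θ.τ9.M) (lam13 : B12.RunParams → ResidB13 θ.toStage3Params) (Mstar : ℕ) (opsY : OpsY N θ.toStage3Params Mstar)
    (ζ : ResidZ F N) (lamW : ResidW F N) (hD : 2 ≤ θ.toStage3Params.D) (lam₀ : ResidB8 θ.toStage3Params)
    {B₀'H B₂' BG BR cL : ℝ} (hB₀'H : 0 < B₀'H) (hB₂' : 0 ≤ B₂') (hBG : 0 ≤ BG) (hBR : 0 ≤ BR) (hcL : 0 < cL)
    (SLet : ∀ i : ZdIdx θ.toStage3Params.D θ.toStage3Params.L, i.Ω 0 = Set.univ → IdxB8LawsB θ.toStage3Params.L i → SockLettersRD (𝔸 := θ.toStage3Params.𝔸) θ.toStage3Params.L BG BR B₀'H B₂' cL i.η i.k i.Ω i.Λs)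
    (SLetUB : ∀ i : ZdIdx θ.toStage3Params.D θ.toStage3Params.L, i.Ω 0 = Set.univ → IdxB8LawsB θ.toStage3Params.L i → ∀ α₀ : ℝ, 0 < α₀ → α₀ ≤ cL → ∀ U₀ : Site θ.toStage3Params.D → Fin θ.toStage3Params.D → θ.toStage3Params.𝔸ˣ, (∀ x κ, U₀ x κ ∈ unitaryUnits θ.toStage3Params.𝔸) →
      InAk θ.toStage3Params.L i.k i.η α₀ i.Ω U₀ →
      ∃ (g Δ : (Site θ.toStage3Params.D → θ.toStage3Params.𝔸) →ₗ[ℂ] (Site θ.toStage3Params.D → θ.toStage3Params.𝔸)) (q : (Site θ.toStage3Params.D → θ.toStage3Params.𝔸) →ₗ[ℂ] (ℕ → Site θ.toStage3Params.D → θ.toStage3Params.𝔸))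
        (qs : (ℕ → Site θ.toStage3Params.D → θ.toStage3Params.𝔸) →ₗ[ℂ] (Site θ.toStage3Params.D → θ.toStage3Params.𝔸)) (Aw c : (ℕ → Site θ.toStage3Params.D → θ.toStage3Params.𝔸) →ₗ[ℂ] (ℕ → Site θ.toStage3Params.D → θ.toStage3Params.𝔸))
        (H' : XSpace θ.toStage3Params.D i.k θ.toStage3Params.𝔸 →ₗ[ℂ] (Site θ.toStage3Params.D → θ.toStage3Params.𝔸)),
        (∀ x : Site θ.toStage3Params.D → θ.toStage3Params.𝔸, (∃ C : ℝ, ∀ y, ‖x y‖ ≤ C) → g (Δ x + qs (Aw (q x))) = x) ∧ (∀ φ, qs (c (q (g (g (qs φ))))) = qs φ) ∧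
        (∀ (f : Site θ.toStage3Params.D → θ.toStage3Params.𝔸), ∀ x ∈ i.Ω 0, Δ f x = covLap i.η U₀ ((i.Ω 0).indicator f) x) ∧
        (∀ (μ : ℕ → Site θ.toStage3Params.D → θ.toStage3Params.𝔸), ∀ x ∈ i.Ω 0, qs μ x = QT θ.toStage3Params.L i.k (i.Λs i.k) U₀ μ x) ∧
        (∀ (f : Site θ.toStage3Params.D → θ.toStage3Params.𝔸) (n : ℕ), n ≤ i.k → ∀ y ∈ i.Λs i.k n, q f n y = QprimeIter (zdBlocking θ.toStage3Params.D θ.toStage3Params.L) (bgT θ.toStage3Params.L U₀) n f y) ∧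
        (∀ (f : Site θ.toStage3Params.D → θ.toStage3Params.𝔸) (n : ℕ) (y : Site θ.toStage3Params.D), ¬ (n ≤ i.k ∧ y ∈ i.Λs i.k n) → q f n y = 0) ∧
        (∀ (X : XSpace θ.toStage3Params.D i.k θ.toStage3Params.𝔸) (x : Site θ.toStage3Params.D), ‖H' X x‖ ≤ B₀'H * ‖X‖) ∧
        (∀ n, n ≤ i.k → ∀ (X : XSpace θ.toStage3Params.D i.k θ.toStage3Params.𝔸), ∀ p ∈ {b : Site θ.toStage3Params.D × Fin θ.toStage3Params.D | SideTouches (i.Ω n) b.1 b.2},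
          wt θ.toStage3Params.L i.η n * ‖covDerivFwd i.η U₀ p.2 (H' X) p.1‖ ≤ B₀'H * ‖X‖) ∧
        (∀ X : XSpace θ.toStage3Params.D i.k θ.toStage3Params.𝔸, Bd2 θ.toStage3Params.L i.η i.k i.Ω (covLap i.η U₀ (H' X)) (B₂' * ‖X‖)) ∧
        (∀ (Y : XSpace θ.toStage3Params.D i.k θ.toStage3Params.𝔸) (n : ℕ) (hn : n ≤ i.k) (y : Site θ.toStage3Params.D), y ∈ i.Λs i.k n →
          QprimeIter (zdBlocking θ.toStage3Params.D θ.toStage3Params.L) (bgT θ.toStage3Params.L U₀) n (H' Y) y = Y (⟨n, Nat.lt_succ_of_le hn⟩, y)) ∧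
        (∀ (f : Site θ.toStage3Params.D → θ.toStage3Params.𝔸) (r : ℝ), 0 ≤ r → Bd2 θ.toStage3Params.L i.η i.k i.Ω f r →
          (∀ x, ‖g f x‖ ≤ BG * r) ∧ ∀ n, n ≤ i.k → ∀ p ∈ {b : Site θ.toStage3Params.D × Fin θ.toStage3Params.D | SideTouches (i.Ω n) b.1 b.2},
            wt θ.toStage3Params.L i.η n * ‖covDerivFwd i.η U₀ p.2 (g f) p.1‖ ≤ BG * r) ∧
        (∀ (f : Site θ.toStage3Params.D → θ.toStage3Params.𝔸) (r : ℝ), 0 ≤ r → Bd2 θ.toStage3Params.L i.η i.k i.Ω f r → Bd2 θ.toStage3Params.L i.η i.k i.Ω (f - g (qs (c (q (g f))))) (BR * r)))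
    -- PROPOSITION 5's INDEX READ AS OBJECTS: `zdLan` members obeying the member laws, with [4]'s letters at each (RD currency), as in p521275
    {J : Type} (ι : J → ZdLanIdx θ.toStage3Params.D θ.toStage3Params.𝔸)
    (hΩ0L : ∀ a : J, (ι a).Ω 0 = Set.univ) (hΩL : ∀ a : J, ∀ j, (ι a).Ω (j + 1) ⊆ (ι a).Ω j)
    (htowerL : ∀ a : J, ∀ j, j ≤ (ι a).k → ∀ y ∈ (ι a).Λ j, ∀ x, InBox (tlo θ.toStage3Params.L y j) (thi θ.toStage3Params.L y j) x → x ∈ (ι a).Ω j)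
    (SLetL : ∀ a : J, ∀ α₀ : ℝ, 0 < α₀ → α₀ ≤ cL → InAk θ.toStage3Params.L (ι a).k (ι a).η α₀ (ι a).Ω (ι a).U₀ →
      ∃ (g Δ : (Site θ.toStage3Params.D → θ.toStage3Params.𝔸) →ₗ[ℂ] (Site θ.toStage3Params.D → θ.toStage3Params.𝔸)) (q : (Site θ.toStage3Params.D → θ.toStage3Params.𝔸) →ₗ[ℂ] (ℕ → Site θ.toStage3Params.D → θ.toStage3Params.𝔸))
        (qs : (ℕ → Site θ.toStage3Params.D → θ.toStage3Params.𝔸) →ₗ[ℂ] (Site θ.toStage3Params.D → θ.toStage3Params.𝔸)) (Aw c : (ℕ → Site θ.toStage3Params.D → θ.toStage3Params.𝔸) →ₗ[ℂ] (ℕ → Site θ.toStage3Params.D → θ.toStage3Params.𝔸))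
        (H' : XSpace θ.toStage3Params.D (ι a).k θ.toStage3Params.𝔸 →ₗ[ℂ] (Site θ.toStage3Params.D → θ.toStage3Params.𝔸)),
        (∀ x, ∀ y ∈ (ι a).Ω 0, (Δ (g x) + qs (Aw (q (g x)))) y = x y) ∧ (∀ f, q (g (g (qs (c (q f))))) = q f) ∧
        (∀ (f : Site θ.toStage3Params.D → θ.toStage3Params.𝔸), ∀ x ∈ (ι a).Ω 0, Δ f x = covLap (ι a).η (ι a).U₀ (((ι a).Ω 0).indicator f) x) ∧
        (∀ (μ : ℕ → Site θ.toStage3Params.D → θ.toStage3Params.𝔸), ∀ x ∈ (ι a).Ω 0, qs μ x = QT θ.toStage3Params.L (ι a).k (ι a).Λ (ι a).U₀ μ x) ∧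
        (∀ (f : Site θ.toStage3Params.D → θ.toStage3Params.𝔸) (j : ℕ), j ≤ (ι a).k → ∀ y ∈ (ι a).Λ j, q f j y = QprimeIter (zdBlocking θ.toStage3Params.D θ.toStage3Params.L) (bgT θ.toStage3Params.L (ι a).U₀) j f y) ∧
        (∀ (X : XSpace θ.toStage3Params.D (ι a).k θ.toStage3Params.𝔸) (x : Site θ.toStage3Params.D), ‖H' X x‖ ≤ B₀'H * ‖X‖) ∧
        (∀ j, j ≤ (ι a).k → ∀ (X : XSpace θ.toStage3Params.D (ι a).k θ.toStage3Params.𝔸), ∀ p ∈ {b : Site θ.toStage3Params.D × Fin θ.toStage3Params.D | SideTouches ((ι a).Ω j) b.1 b.2},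
          wt θ.toStage3Params.L (ι a).η j * ‖covDerivFwd (ι a).η (ι a).U₀ p.2 (H' X) p.1‖ ≤ B₀'H * ‖X‖) ∧
        (∀ X : XSpace θ.toStage3Params.D (ι a).k θ.toStage3Params.𝔸, Bd2 θ.toStage3Params.L (ι a).η (ι a).k (ι a).Ω (covLap (ι a).η (ι a).U₀ (H' X)) (B₂' * ‖X‖)) ∧
        (∀ (X : XSpace θ.toStage3Params.D (ι a).k θ.toStage3Params.𝔸) (x : Site θ.toStage3Params.D), x ∉ (ι a).Ω 0 → H' X x = 0) ∧
        (∀ X Y : XSpace θ.toStage3Params.D (ι a).k θ.toStage3Params.𝔸, (∀ p, Y p = -star (X p)) → ∀ x, H' Y x = -star (H' X x)) ∧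
        (∀ (Y : XSpace θ.toStage3Params.D (ι a).k θ.toStage3Params.𝔸) (j : ℕ) (hj : j ≤ (ι a).k) (y : Site θ.toStage3Params.D), y ∈ (ι a).Λ j →
          QprimeIter (zdBlocking θ.toStage3Params.D θ.toStage3Params.L) (bgT θ.toStage3Params.L (ι a).U₀) j (H' Y) y = Y (⟨j, Nat.lt_succ_of_le hj⟩, y)) ∧
        (∀ (f : Site θ.toStage3Params.D → θ.toStage3Params.𝔸) (r : ℝ), 0 ≤ r → Bd2 θ.toStage3Params.L (ι a).η (ι a).k (ι a).Ω f r →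
          (∀ x, ‖g f x‖ ≤ BG * r) ∧ ∀ j, j ≤ (ι a).k → ∀ p ∈ {b : Site θ.toStage3Params.D × Fin θ.toStage3Params.D | SideTouches ((ι a).Ω j) b.1 b.2},
            wt θ.toStage3Params.L (ι a).η j * ‖covDerivFwd (ι a).η (ι a).U₀ p.2 (g f) p.1‖ ≤ BG * r) ∧
        (∀ (f : Site θ.toStage3Params.D → θ.toStage3Params.𝔸) (x : Site θ.toStage3Params.D), x ∉ (ι a).Ω 0 → g f x = 0) ∧
        (∀ f : Site θ.toStage3Params.D → θ.toStage3Params.𝔸, (∀ j, j ≤ (ι a).k → ∀ x ∈ (ι a).Ω j, IsSelfAdjoint (f x)) → ∀ x, IsSelfAdjoint (g f x)) ∧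
        (∀ (f : Site θ.toStage3Params.D → θ.toStage3Params.𝔸) (r : ℝ), 0 ≤ r → Bd2 θ.toStage3Params.L (ι a).η (ι a).k (ι a).Ω f r →
          Bd2 θ.toStage3Params.L (ι a).η (ι a).k (ι a).Ω (f - g (qs (c (q (g f))))) (BR * r)) ∧
        (∀ f : Site θ.toStage3Params.D → θ.toStage3Params.𝔸, (∀ j, j ≤ (ι a).k → ∀ x ∈ (ι a).Ω j, IsSelfAdjoint (f x)) →
          ∀ j, j ≤ (ι a).k → ∀ x ∈ (ι a).Ω j, IsSelfAdjoint ((f - g (qs (c (q (g f))))) x)))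
    (SLetLU : ∀ a : J, ∀ α₀ : ℝ, 0 < α₀ → α₀ ≤ cL → InAk θ.toStage3Params.L (ι a).k (ι a).η α₀ (ι a).Ω (ι a).U₀ →
      ∃ (g Δ : (Site θ.toStage3Params.D → θ.toStage3Params.𝔸) →ₗ[ℂ] (Site θ.toStage3Params.D → θ.toStage3Params.𝔸)) (q : (Site θ.toStage3Params.D → θ.toStage3Params.𝔸) →ₗ[ℂ] (ℕ → Site θ.toStage3Params.D → θ.toStage3Params.𝔸)) (qs : (ℕ → Site θ.toStage3Params.D → θ.toStage3Params.𝔸) →ₗ[ℂ] (Site θ.toStage3Params.D → θ.toStage3Params.𝔸))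
        (Aw c : (ℕ → Site θ.toStage3Params.D → θ.toStage3Params.𝔸) →ₗ[ℂ] (ℕ → Site θ.toStage3Params.D → θ.toStage3Params.𝔸)) (H' : XSpace θ.toStage3Params.D (ι a).k θ.toStage3Params.𝔸 →ₗ[ℂ] (Site θ.toStage3Params.D → θ.toStage3Params.𝔸)),
        (∀ x : Site θ.toStage3Params.D → θ.toStage3Params.𝔸, (∃ C : ℝ, ∀ y, ‖x y‖ ≤ C) → g (Δ x + qs (Aw (q x))) = x) ∧ (∀ φ, qs (c (q (g (g (qs φ))))) = qs φ) ∧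
        (∀ (f : Site θ.toStage3Params.D → θ.toStage3Params.𝔸), ∀ x ∈ (ι a).Ω 0, Δ f x = covLap (ι a).η (ι a).U₀ (((ι a).Ω 0).indicator f) x) ∧
        (∀ (μ : ℕ → Site θ.toStage3Params.D → θ.toStage3Params.𝔸), ∀ x ∈ (ι a).Ω 0, qs μ x = QT θ.toStage3Params.L (ι a).k (ι a).Λ (ι a).U₀ μ x) ∧
        (∀ (f : Site θ.toStage3Params.D → θ.toStage3Params.𝔸) (n : ℕ), n ≤ (ι a).k → ∀ y ∈ (ι a).Λ n, q f n y = QprimeIter (zdBlocking θ.toStage3Params.D θ.toStage3Params.L) (bgT θ.toStage3Params.L (ι a).U₀) n f y) ∧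
        (∀ (f : Site θ.toStage3Params.D → θ.toStage3Params.𝔸) (n : ℕ) (y : Site θ.toStage3Params.D), ¬ (n ≤ (ι a).k ∧ y ∈ (ι a).Λ n) → q f n y = 0) ∧
        (∀ (X : XSpace θ.toStage3Params.D (ι a).k θ.toStage3Params.𝔸) (x : Site θ.toStage3Params.D), ‖H' X x‖ ≤ B₀'H * ‖X‖) ∧
        (∀ n, n ≤ (ι a).k → ∀ (X : XSpace θ.toStage3Params.D (ι a).k θ.toStage3Params.𝔸), ∀ p ∈ {b : Site θ.toStage3Params.D × Fin θ.toStage3Params.D | SideTouches ((ι a).Ω n) b.1 b.2},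
          wt θ.toStage3Params.L (ι a).η n * ‖covDerivFwd (ι a).η (ι a).U₀ p.2 (H' X) p.1‖ ≤ B₀'H * ‖X‖) ∧
        (∀ X : XSpace θ.toStage3Params.D (ι a).k θ.toStage3Params.𝔸, Bd2 θ.toStage3Params.L (ι a).η (ι a).k (ι a).Ω (covLap (ι a).η (ι a).U₀ (H' X)) (B₂' * ‖X‖)) ∧
        (∀ (Y : XSpace θ.toStage3Params.D (ι a).k θ.toStage3Params.𝔸) (n : ℕ) (hn : n ≤ (ι a).k) (y : Site θ.toStage3Params.D), y ∈ (ι a).Λ n →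
          QprimeIter (zdBlocking θ.toStage3Params.D θ.toStage3Params.L) (bgT θ.toStage3Params.L (ι a).U₀) n (H' Y) y = Y (⟨n, Nat.lt_succ_of_le hn⟩, y)) ∧
        (∀ (f : Site θ.toStage3Params.D → θ.toStage3Params.𝔸) (r : ℝ), 0 ≤ r → Bd2 θ.toStage3Params.L (ι a).η (ι a).k (ι a).Ω f r →
          (∀ x, ‖g f x‖ ≤ BG * r) ∧ ∀ n, n ≤ (ι a).k → ∀ p ∈ {b : Site θ.toStage3Params.D × Fin θ.toStage3Params.D | SideTouches ((ι a).Ω n) b.1 b.2},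
            wt θ.toStage3Params.L (ι a).η n * ‖covDerivFwd (ι a).η (ι a).U₀ p.2 (g f) p.1‖ ≤ BG * r) ∧
        (∀ (f : Site θ.toStage3Params.D → θ.toStage3Params.𝔸) (r : ℝ), 0 ≤ r → Bd2 θ.toStage3Params.L (ι a).η (ι a).k (ι a).Ω f r →
          Bd2 θ.toStage3Params.L (ι a).η (ι a).k (ι a).Ω (f - g (qs (c (q (g f))))) (BR * r)))
    -- N06 BY NAME: [Balaban1985BackgroundPropagators] THEOREM 3.3 as typed by the N06 lineage (the `t33` conjunct of the [B9] leaf), for an abstract indexed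
    -- geometry ∕ background ∕ kernel family, and dag-n06-b's member-local OPERATOR DICTIONARY at the `Ω₀ = ℤᵈ` LAW MEMBERS (object layer: the index map `mem`,
    -- configuration ∕ location transports `ιCfg ∕ ιLoc`, operator letters `ops`) — hypotheses; `Prop6At` is [Balaban1985RegularSpaces] Prop. 6 (1.136) in
    -- [4]'s dress (3.35), N05-OWN content displayed
    {I : Type} (geo : I → B9.Geometry) (bg : I → B9.Backgrounds) (GA : ∀ i, B9.KernelFamily (geo i) (bg i)) {Gp : ∀ i, B9.KernelFamily (geo i) (bg i)}
    (mem : ℝ → ZdIdx θ.toStage3Params.D θ.toStage3Params.L → ℕ → I)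
    (ιCfg : ∀ (M : ℝ) (i : ZdIdx θ.toStage3Params.D θ.toStage3Params.L) (m : ℕ) (U₀ : Site θ.toStage3Params.D → Fin θ.toStage3Params.D → θ.toStage3Params.𝔸ˣ), (∀ x κ, U₀ x κ ∈ unitaryUnits θ.toStage3Params.𝔸) → (bg (mem M i m)).Cfg)
    (ιLoc : ∀ (M : ℝ) (i : ZdIdx θ.toStage3Params.D θ.toStage3Params.L) (m : ℕ), (Site θ.toStage3Params.D → Fin θ.toStage3Params.D → θ.toStage3Params.𝔸) → (geo (mem M i m)).Loc)
    (ops : ℝ → ZdIdx θ.toStage3Params.D θ.toStage3Params.L → ℕ → OpsZd θ.toStage3Params.D θ.toStage3Params.𝔸)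
    {c35 c₆ K₆ M₃ a₃ c69 q CH cS cSβ : ℝ} (h33 : B9.Thm33Printed c35 geo bg Gp GA)
    (hdict : ∀ (M : ℝ) (i : ZdIdx θ.toStage3Params.D θ.toStage3Params.L), i.Ω 0 = Set.univ → IdxB8LawsB θ.toStage3Params.L i → ∀ m : ℕ, DictAt geo bg GA θ.toStage3Params.L mem ιCfg ιLoc ops M i m)
    (hP6at : ∀ (M : ℝ) (i : ZdIdx θ.toStage3Params.D θ.toStage3Params.L), i.Ω 0 = Set.univ → IdxB8LawsB θ.toStage3Params.L i → ∀ m : ℕ, M₃ ≤ M → Prop6At bg θ.toStage3Params.L mem ιCfg c35 c₆ K₆ M i m)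
    (hinv : ∀ (M : ℝ) (i : ZdIdx θ.toStage3Params.D θ.toStage3Params.L), i.Ω 0 = Set.univ → IdxB8LawsB θ.toStage3Params.L i → ∀ m : ℕ, M₃ ≤ M → InvAt bg θ.toStage3Params.L mem ιCfg ops c35 a₃ M i m)
    (hcurv : ∀ (M : ℝ) (i : ZdIdx θ.toStage3Params.D θ.toStage3Params.L), i.Ω 0 = Set.univ → IdxB8LawsB θ.toStage3Params.L i → ∀ m : ℕ, M₃ ≤ M → CurvAt bg θ.toStage3Params.L mem ιCfg ops c35 a₃ c69 M i m)
    (hlan : ∀ (M : ℝ) (i : ZdIdx θ.toStage3Params.D θ.toStage3Params.L), i.Ω 0 = Set.univ → IdxB8LawsB θ.toStage3Params.L i → ∀ m : ℕ, M₃ ≤ M → LandauAt bg θ.toStage3Params.L mem ιCfg ops c35 a₃ M i m)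
    (havg : ∀ (M : ℝ) (i : ZdIdx θ.toStage3Params.D θ.toStage3Params.L), i.Ω 0 = Set.univ → IdxB8LawsB θ.toStage3Params.L i → ∀ m : ℕ, AvgAt θ.toStage3Params.L ops q M i m)
    (hhol : ∀ (M : ℝ) (i : ZdIdx θ.toStage3Params.D θ.toStage3Params.L), i.Ω 0 = Set.univ → IdxB8LawsB θ.toStage3Params.L i → ∀ m : ℕ, HolderAt geo bg GA θ.toStage3Params.L mem ιCfg ops lam₀.β lam₀.len CH M i m)
    (hadd : ∀ (M : ℝ) (i : ZdIdx θ.toStage3Params.D θ.toStage3Params.L), i.Ω 0 = Set.univ → IdxB8LawsB θ.toStage3Params.L i → ∀ m : ℕ, GopAddAt θ.toStage3Params.L ops M i m)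
    (hsrc : ∀ (M : ℝ) (i : ZdIdx θ.toStage3Params.D θ.toStage3Params.L), i.Ω 0 = Set.univ → IdxB8LawsB θ.toStage3Params.L i → ∀ m : ℕ, M₃ ≤ M → SrcAt bg θ.toStage3Params.L mem ιCfg ops c35 a₃ cS M i m)
    (hsrcH : ∀ (M : ℝ) (i : ZdIdx θ.toStage3Params.D θ.toStage3Params.L), i.Ω 0 = Set.univ → IdxB8LawsB θ.toStage3Params.L i → ∀ m : ℕ, M₃ ≤ M →
      SrcHolderAt bg θ.toStage3Params.L mem ιCfg ops c35 a₃ lam₀.β lam₀.len cSβ M i m)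
    (hc₆ : 0 < c₆) (hK₆ : 0 < K₆) (ha₃ : 0 < a₃) (hc69 : 0 ≤ c69) (hq : 0 ≤ q) (hcS : 0 ≤ cS) (hcSβ : 0 ≤ cSβ)
    -- N05's OWN PRINTED MEMBERS (displayed hypotheses): Proposition 6 on the record's cube family at a consumer threshold `(B₁⁰, c₁)`; Proposition 7 for `lam₀`'s axial map
    (B₁₀ c₁ : ℝ) (p6 : B8.Prop6Printed θ.toStage3Params.D (θ.toStage3Params.L : ℝ) B₁₀ c₁ (fun j : IdxB8SubB θ.toStage3Params => cubB8OfRecord θ.toStage3Params j.1))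
    (p7 : B8SectGH.Prop7PrintedR (fun j : IdxB8SubB θ.toStage3Params => famB8OfRecordSubB θ.toStage3Params lam₀.β lam₀.len j) (fun j => lam₀.toAxial j.1))
    {γw : ℝ} (hγ0 : 0 < γw) (hγ1 : γw ≤ θ.γ) :
    ∃ (inp : B8.B9Inputs) (C₂ B₁' B₁ B₂ B₀β : ℝ), B₁₀ ≤ B₁ ∧
    ∃ w w' : WorldP, IsRecordOfRecord₁₃CSepCoPHSX3HV F N (datumOfRecord₁₃SepCoPH F N θ h) w ∧
      w.C = (datumOfRecord₁₃SepCoPH F N θ h).C ∧ w.γ = γw ∧ w.L = (θ.L : ℝ) ∧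
      (∀ P : B12.RunParams, w.up P =
        upOfRecord₅CS F N ((θ.pinX3H F N ((({ lam₀ with inp := inp, C₂ := C₂, B₁' := B₁', B₁ := B₁, B₂ := B₂, B₀β := B₀β } : ResidB8 θ.toStage3Params).cutSubB J
          (fun a : J => zdLan θ.toStage3Params.L B₁ (ι a)) c₁)) lam12 lam13).view₁₃CoPHB10YZW F N Mstar opsY ζ lamW) P) ∧
      (∀ P : B12.RunParams, (leavesP w P).b8 ∧ Dag.B8_main (leavesP w P)) ∧
      IsRecordOfRecord₁₃CSepCoPH F N (datumOfRecord₁₃SepCoPH F N θ h) w' ∧ w'.C = w.C ∧ w'.γ = w.γ ∧ w'.L = w.L ∧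
      ∀ P : B12.RunParams, leavesP w P = { leavesP w' P with b8 := (leavesP w P).b8 } := by
  obtain ⟨inp, C₂, B₁', B₁, B₂, B₀β, hB₁, hleaf⟩ := exists_b8LeafOfRecordSubBH_cutSubB_zdLan_of_thm33_lettersRDU_univ hD lam₀ hB₀'H hB₂' hBG hBR hcL
    SLet SLetUB ι hΩ0L hΩL htowerL SLetL SLetLU geo bg GA mem ιCfg ιLoc ops h33 hdict hP6at hinv hcurv hlan havg hhol hadd hsrc hsrcH
    hc₆ hK₆ ha₃ hc69 hq hcS hcSβ B₁₀ c₁ p6 p7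
  exact ⟨inp, C₂, B₁', B₁, B₂, B₀β, hB₁,
    exists_isRecordOfRecord₁₃CSepCoPHSX3HV_b8_of_leaf θ h hθ _ lam12 lam13 Mstar opsY ζ lamW hleaf hγ0 hγ1⟩

end Record

#print axioms exists_isRecordOfRecord₁₃CSepCoPHSX3HV_b8_of_thm33_lettersRDU_univ

end Summit.QuantumFields.YangMills.BalabanUVNodes.N05AtXPinnedHSViewSepCoPHOfThm33

end
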